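import Literature.MathematicalPhysics.QuantumFieldTheory.Balaban1983to89.B12Ineq417DeltaB

/-!
# `Balaban1983to89.B12Ineq418DeltaB` — [Balaban1987RG1] p. 285: «The inequalities (4.17), (4.18) hold for the field δB also» —
the (4.18) half (second differences of `δB = ⟨(δ/δA)Q_j(ηA), W⟩`), at a background invariant under the two translations (in
particular `U₀ = 1 = U_j(□₀, 1)` of (4.19)) from displayed inputs (chart + analyticity + size of `Q_j(U₀, ·)`) by Cauchy estimates for
first derivatives and their mixed second differences, with the inputs DISCHARGED at `U₀ = 1`

HONEST FRAMING (cell `lit-balaban`, verbatim): statement-level skeleton of published theorems with citation tags; proofs where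
landed; nothing here is a claim about the Yang–Mills mass gap.

CITATION HEADER.  T. Bałaban, *Renormalization group approach to lattice gauge field theories. I*, Commun. Math. Phys. **109** (1987)
249–301 [Balaban1987RG1] (cell paper B12; journal page = PDF page + 248): (4.6) p. 282 (the field `δB`), (4.18) p. 285 («we do not have
bounds for second order derivatives of the field A, only for Hölder norms of first order derivatives in (3.32). They imply the bound
|(∂_λ∂_νB_μ)(x)| < α₁(L^jη)^{2+β}, 0 < β₀ ≤ β < 1»), and «The inequalities (4.17), (4.18) hold for the field δB also» (p. 285);
T. Bałaban, *Averaging operations for lattice gauge theories*, Commun. Math. Phys. **98** (1985) 17–51 [Balaban1985Averaging] (cell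
paper B7), Proposition 4 p. 38 ((131), analyticity), Proposition 5 p. 42 ((156)–(157); proved pp. 40–41), (127) p. 37.  Unit `lit-balaban-r20` gen 4 (fold owner of
B12): SUPPLEMENT to row B12.Eq4.16-4.18 (owner cell r09 `typed p243650`), sequel of `B12Ineq418Flat` (p247232: (4.18) for `B`) and
`B12Ineq417DeltaB` (p248023: (4.17) for `δB`).

THE MECHANISM.  With `t_λ = t_{L^je_λ}`, `t_ν = t_{L^je_ν}` and a background invariant under both, translation covariance
(`B12Ineq417DeltaB.dQ_shiftCfg`) writes the four values of `δQ(U₀; F; W)` at `z, z+e_λ, z+e_ν, z+e_λ+e_ν` as `Φ(q_{ab}, u_{ab}) =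
Dφ(q_{ab})[u_{ab}]`, `q_{ab} = (t_λ^a t_ν^b F)|_S`, `u_{ab} = (t_λ^a t_ν^b W)|_S`, through ONE chart `φ` (`dQ_eq_fderiv_of_chart`).  Linearity in
the direction splits the mixed second difference `Σ ± Φ(q_{ab}, u_{ab})` into FIVE pieces (`secondDiff_split`): (Ia) the `Z`-correction
`Φ(q₁₁, u) − Φ(q₀₀+V+W′, u)` (`Z` = the restricted double difference `dd2Cfg` of `F`, size `L^jg₂` from the HÖLDER-type input on `F`,
`B12Ineq418Flat.norm_dd2Cfg_le`), (Ib) the pure mixed second difference of the holomorphic `q ↦ Φ(q, u)` along `V = (t_λF − F)|_S`,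
`W′ = (t_νF − F)|_S` (`B12Ineq418Flat.norm_secondDiff_le`: `≤ (Mω/ρ)‖V‖‖W′‖/ρ²`), (II)/(III) the cross terms `Φ(q₁₁, δ_λu) − Φ(q₁₀, δ_λu)`,
`Φ(q₁₁, δ_νu) − Φ(q₀₁, δ_νu)` (`B12Ineq417General.norm_sub_le_of_chart` on `q ↦ Φ(q, δu)`), (IV) `Φ(q₁₁, δ²u)` with `δ²u` the restricted
double difference of `W` (size `L^jg₂^W`, the Hölder-type input on `W`).  RESULT (`ineq418_deltaB_invariant`):
`‖Δ_λΔ_ν δB_μ(z)‖ ≤ (Mω/ρ)(L^jg₂/ρ + L^jg_λ·L^jg_ν/ρ²) + M(L^jg^W_λ·L^jg_ν + L^jg^W_ν·L^jg_λ)/ρ² + M·L^jg₂^W/ρ`; at `U₀ = 1` all chart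
inputs are discharged (`ineq418_deltaB_flat`, `M = 2L^jb₁`).  DICTIONARY ((3.32), as in `B12Ineq418Flat`): `M = O(L^jη)`, `ω, ρ = O(η)`,
`g = O(η²)`, `g₂, g₂^W = O(η²(L^jη)^β)` (Hölder) ⟹ every term is `O(1)(L^jη)^{2+β}` (using `L^jη ≤ 1`) — (4.18) for `δB`.

WHAT THIS FILE PROVES (kernel, 0 sorry, standard axioms; no definitions, no `def … : Prop`): `norm_restr_dd2Cfg_le`, `restr_shift2_eq`,
`secondDiff_split` (the five-piece identity for a map linear in its second argument), `norm_add₅_le`, **`ineq418_deltaB_invariant`**,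
**`ineq418_deltaB_flat`**.

DIVERGENCES / NOT PROVED.  `ℤ^d`, no torus; constants OURS; only backgrounds invariant under `t_λ, t_ν` (a general background would add
second-order background-variation terms, not treated); the Hölder inputs enter as the sizes `g₂`, `g₂^W` of double differences (the
dictionary with `‖·‖_{1,β}` of (3.32) is the header's, as in `B12Ineq418Flat`).
DOCFIX (r20 g20, 2026-08-22): quotation span of `ineq418_deltaB_flat` corrected to the print — QF57-004 (summit-lit1 g57 `qfid_slips_g57.tsv`, confirmed r09 g19 / r20 g20 on `paper:balaban1987-cmp109-rg-i-small-field` p0037 L21–22: «The inequalities (4.17), (4.18) hold for the field δB also.»); docstring-only, declarations byte-identical.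
-/

noncomputable section

open scoped BigOperators
open Set Metric
open Literature.MathematicalPhysics.QuantumFieldTheory.Balaban1983to89
open Literature.MathematicalPhysics.QuantumFieldTheory.Balaban1983to89.B7Prop1Explicit (e)
open Literature.MathematicalPhysics.QuantumFieldTheory.Balaban1983to89.B7Prop3Flat (insCfg)
open Literature.MathematicalPhysics.QuantumFieldTheory.Balaban1983to89.B7Prop4Flat (logIter)
open Literature.MathematicalPhysics.QuantumFieldTheory.Balaban1983to89.B7Prop5Flat (C3 C3_pos restr)
open Literature.MathematicalPhysics.QuantumFieldTheory.Balaban1983to89.B7Prop5FlatOperator (avgMap avgMap_apply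
  analyticAt_avgMap_apply norm_insCfg_le_of_le)
open Literature.MathematicalPhysics.QuantumFieldTheory.Balaban1983to89.B7Prop4GeneralLevels (logCovIter logCovIter_one_left)
open Literature.MathematicalPhysics.QuantumFieldTheory.Balaban1983to89.B12Ineq417Flat (shiftCfg shiftCfg_apply shiftCfg_shiftCfg
  boxBonds oneBond theBond logIter_eq_avgMap_restr norm_logIter_le)
open Literature.MathematicalPhysics.QuantumFieldTheory.Balaban1983to89.B12Ineq418Flat (norm_secondDiff_le dd2Cfg norm_dd2Cfg_le)
open Literature.MathematicalPhysics.QuantumFieldTheory.Balaban1983to89.B7TranslationCovariance (shiftCfg_one)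
open Literature.MathematicalPhysics.QuantumFieldTheory.Balaban1983to89.B12Ineq417General (norm_sub_le_of_chart norm_restr_le
  norm_restr_shift_sub_le)
open Literature.MathematicalPhysics.QuantumFieldTheory.Balaban1983to89.B12Ineq417DeltaB (dQ dQ_shiftCfg dQ_eq_fderiv_of_chart
  norm_fderiv_apply_le_of_chart differentiableOn_fderiv_apply)

namespace Literature.MathematicalPhysics.QuantumFieldTheory.Balaban1983to89.B12Ineq418DeltaB

variable {d : ℕ}

/-! ## §1 Sizes of the restricted data and the five-piece identity -/

section Algebra

variable {𝔸 : Type*} [NormedRing 𝔸] [NormedAlgebra ℂ 𝔸] [CompleteSpace 𝔸]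

omit [NormedAlgebra ℂ 𝔸] [CompleteSpace 𝔸] in
/-- **The restricted double difference costs `L^j` Hölder-type inputs**: `‖(t_{a+L^je_ν}F − t_aF − t_{L^je_ν}F + F)|_S‖ ≤ L^j·g₂` when
`|[∇_νF](y + a) − [∇_νF](y)| ≤ g₂` for all `y`. [cite: Balaban1987RG1, (4.18) p.285, (3.32) p.277] -/
theorem norm_restr_dd2Cfg_le (S : Finset (B7Prop1Explicit.Site d × Fin d)) (a : B7Prop1Explicit.Site d)
    (F : B7Prop1Explicit.Site d → Fin d → 𝔸) (L j : ℕ) (ν : Fin d) {g₂ : ℝ} (hg0 : 0 ≤ g₂)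
    (hG : ∀ y κ, ‖(F (y + a + e ν) κ - F (y + a) κ) - (F (y + e ν) κ - F y κ)‖ ≤ g₂) :
    ‖restr S (dd2Cfg a (((L : ℤ) ^ j) • e ν) F)‖ ≤ (L : ℝ) ^ j * g₂ := by
  refine (pi_norm_le_iff_of_nonneg (by positivity)).2 fun s => ?_
  have h := norm_dd2Cfg_le a (L ^ j) ν F hG s.1.1 s.1.2
  have hcast : (((L ^ j : ℕ) : ℤ)) • e ν = ((L : ℤ) ^ j) • e ν := by push_cast; rfl
  rw [hcast] at h
  simpa [restr] using h

omit [NormedAlgebra ℂ 𝔸] [CompleteSpace 𝔸] in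
/-- The doubly translated field through the double difference: `(t_{a+a′}F)|_S = F|_S + (t_aF − F)|_S + (t_{a′}F − F)|_S + (dd2Cfg a a′ F)|_S`.
[cite: Balaban1987RG1, (4.18) p.285] (elementary API; our proof) -/
theorem restr_shift2_eq (S : Finset (B7Prop1Explicit.Site d × Fin d)) (a a' : B7Prop1Explicit.Site d)
    (F : B7Prop1Explicit.Site d → Fin d → 𝔸) :
    restr S (shiftCfg (a + a') F)
      = restr S F + (restr S (shiftCfg a F) - restr S F) + (restr S (shiftCfg a' F) - restr S F) + restr S (dd2Cfg a a' F) := by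
  funext s
  simp only [restr, dd2Cfg, Pi.add_apply, Pi.sub_apply]
  abel

omit [CompleteSpace 𝔸] in
/-- **The five-piece identity** for a map `Φ(q, u)` additive in `u`: with `u₁₀ = u + d_λ`, `u₀₁ = u + d_ν`, `u₁₁ = u + d_λ + d_ν + d₂`,
`Φ(q₁₁,u₁₁) − Φ(q₁₀,u₁₀) − Φ(q₀₁,u₀₁) + Φ(q₀₀,u) = [Φ(q₁₁,u) − Φ(q′,u)] + [Φ(q′,u) − Φ(q₁₀,u) − Φ(q₀₁,u) + Φ(q₀₀,u)]
+ [Φ(q₁₁,d_λ) − Φ(q₁₀,d_λ)] + [Φ(q₁₁,d_ν) − Φ(q₀₁,d_ν)] + Φ(q₁₁,d₂)` for any intermediate point `q′`.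
[cite: Balaban1987RG1, (4.18) p.285] (elementary algebra; our proof) -/
theorem secondDiff_split {P : Type*} [NormedAddCommGroup P] [NormedSpace ℂ P] (Φ : P → (P →L[ℂ] 𝔸)) (q11 q10 q01 q00 q' : P) (u dL dN d2 : P) :
    Φ q11 (u + dL + dN + d2) - Φ q10 (u + dL) - Φ q01 (u + dN) + Φ q00 u
      = (Φ q11 u - Φ q' u) + (Φ q' u - Φ q10 u - Φ q01 u + Φ q00 u)
        + (Φ q11 dL - Φ q10 dL) + (Φ q11 dN - Φ q01 dN) + Φ q11 d2 := by
  simp only [map_add]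
  abel

omit [NormedAlgebra ℂ 𝔸] [CompleteSpace 𝔸] in
/-- `‖a+b+c+d+e‖ ≤ ‖a‖+‖b‖+‖c‖+‖d‖+‖e‖`. [cite: Balaban1987RG1, (4.18) p.285] (elementary; our proof) -/
theorem norm_add₅_le (a b c d' e' : 𝔸) : ‖a + b + c + d' + e'‖ ≤ ‖a‖ + ‖b‖ + ‖c‖ + ‖d'‖ + ‖e'‖ :=
  le_trans (norm_add_le _ _) (add_le_add (le_trans (norm_add_le _ _) (add_le_add (norm_add₃_le) le_rfl)) le_rfl)

end Algebra

/-! ## §2 (4.18) for `δB` at a background invariant under the two translations, from displayed inputs -/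

section Invariant

variable {𝔸 : Type*} [NormedRing 𝔸] [NormedAlgebra ℂ 𝔸] [CompleteSpace 𝔸]

/-- **(4.18) FOR `δB` FROM DISPLAYED INPUTS, at a background `U₀` invariant under `t_λ = t_{L^je_λ}` and `t_ν = t_{L^je_ν}`.**
INPUTS: (chart) `Q_{j,μ}(U₀, G)(z) = φ(G|_S)` for all `G`; (analyticity) of `φ` on the sup-norm ball of radius `b₁`; (size) `‖φ‖ ≤ M` there;
data: `sup ‖F‖ ≤ b`, fine differences of `F` in the directions `λ`, `ν` bounded by `g_λ, g_ν`, the `(L^je_λ, e_ν)` double differences of `F` `≤ g₂`; `sup ‖W‖ ≤ ω`, fine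
differences of `W` `≤ g^W_λ, g^W_ν`, its double differences `≤ g₂^W`; margin `b + L^jg_λ + L^jg_ν + L^jg₂ + 3ρ ≤ b₁`.  CONCLUSION:
`‖δQ(z+e_λ+e_ν) − δQ(z+e_λ) − δQ(z+e_ν) + δQ(z)‖ ≤ (Mω/ρ)(L^jg₂/ρ + L^jg_λ·L^jg_ν/ρ²) + M(L^jg^W_λ·L^jg_ν + L^jg^W_ν·L^jg_λ)/ρ² + M·L^jg₂^W/ρ`.
[cite: Balaban1987RG1, (4.18) p.285 («hold for the field δB also»), (4.6) p.282; Balaban1985Averaging, Prop. 4 p.38, Prop. 5 p.42] -/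
theorem ineq418_deltaB_invariant (L : ℕ) (U₀ : B7Prop1Explicit.Site d → Fin d → 𝔸ˣ) (F W : B7Prop1Explicit.Site d → Fin d → 𝔸)
    (j : ℕ) (lam nu : Fin d) (z : B7Prop1Explicit.Site d) (μ : Fin d) {S : Finset (B7Prop1Explicit.Site d × Fin d)}
    (φ : (S → 𝔸) → 𝔸) {b b₁ M ω gL gN g₂ gWL gWN g₂W ρ : ℝ}
    (hchart : ∀ G : B7Prop1Explicit.Site d → Fin d → 𝔸, logCovIter L U₀ G j z μ = φ (restr S G))
    (hUL : shiftCfg (((L : ℤ) ^ j) • e lam) U₀ = U₀) (hUN : shiftCfg (((L : ℤ) ^ j) • e nu) U₀ = U₀)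
    (hφ : AnalyticOnNhd ℂ φ (ball 0 b₁)) (hM0 : 0 ≤ M) (hM : ∀ q ∈ ball (0 : S → 𝔸) b₁, ‖φ q‖ ≤ M)
    (hb : 0 ≤ b) (hF : ∀ x κ, ‖F x κ‖ ≤ b)
    (hgL0 : 0 ≤ gL) (hgL : ∀ x κ, ‖F (x + e lam) κ - F x κ‖ ≤ gL)
    (hgN0 : 0 ≤ gN) (hgN : ∀ x κ, ‖F (x + e nu) κ - F x κ‖ ≤ gN)
    (hg₂0 : 0 ≤ g₂) (hG : ∀ y κ, ‖(F (y + ((L : ℤ) ^ j) • e lam + e nu) κ - F (y + ((L : ℤ) ^ j) • e lam) κ)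
      - (F (y + e nu) κ - F y κ)‖ ≤ g₂)
    (hω : 0 ≤ ω) (hW : ∀ x κ, ‖W x κ‖ ≤ ω)
    (hgWL0 : 0 ≤ gWL) (hgWL : ∀ x κ, ‖W (x + e lam) κ - W x κ‖ ≤ gWL)
    (hgWN0 : 0 ≤ gWN) (hgWN : ∀ x κ, ‖W (x + e nu) κ - W x κ‖ ≤ gWN)
    (hg₂W0 : 0 ≤ g₂W) (hGW : ∀ y κ, ‖(W (y + ((L : ℤ) ^ j) • e lam + e nu) κ - W (y + ((L : ℤ) ^ j) • e lam) κ)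
      - (W (y + e nu) κ - W y κ)‖ ≤ g₂W)
    (hρ : 0 < ρ) (hroom : b + (L : ℝ) ^ j * gL + (L : ℝ) ^ j * gN + (L : ℝ) ^ j * g₂ + 3 * ρ ≤ b₁) :
    ‖dQ L U₀ F W j (z + e lam + e nu) μ - dQ L U₀ F W j (z + e lam) μ - dQ L U₀ F W j (z + e nu) μ + dQ L U₀ F W j z μ‖
      ≤ M * ω / ρ * ((L : ℝ) ^ j * g₂ / ρ + ((L : ℝ) ^ j * gL) * ((L : ℝ) ^ j * gN) / ρ ^ 2)
        + M * (((L : ℝ) ^ j * gWL) * ((L : ℝ) ^ j * gN) + ((L : ℝ) ^ j * gWN) * ((L : ℝ) ^ j * gL)) / ρ ^ 2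
        + M * ((L : ℝ) ^ j * g₂W) / ρ := by
  -- names for the two translations
  set aL : B7Prop1Explicit.Site d := ((L : ℤ) ^ j) • e lam with haL
  set aN : B7Prop1Explicit.Site d := ((L : ℤ) ^ j) • e nu with haN
  have hLj : (0 : ℝ) ≤ (L : ℝ) ^ j := by positivity
  have hLgL : (0 : ℝ) ≤ (L : ℝ) ^ j * gL := by positivity
  have hLgN : (0 : ℝ) ≤ (L : ℝ) ^ j * gN := by positivity
  have hLg2 : (0 : ℝ) ≤ (L : ℝ) ^ j * g₂ := by positivity
  -- invariance of the background under the composite translation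
  have hULN : shiftCfg (aL + aN) U₀ = U₀ := by rw [← shiftCfg_shiftCfg, hUN, hUL]
  -- covariance: the four values of δQ through the one chart at U₀
  have c11 : dQ L U₀ F W j (z + e lam + e nu) μ = dQ L U₀ (shiftCfg (aL + aN) F) (shiftCfg (aL + aN) W) j z μ := by
    rw [add_assoc, dQ_shiftCfg, smul_add, ← haL, ← haN, hULN]
  have c10 : dQ L U₀ F W j (z + e lam) μ = dQ L U₀ (shiftCfg aL F) (shiftCfg aL W) j z μ := by
    rw [dQ_shiftCfg, ← haL, hUL]
  have c01 : dQ L U₀ F W j (z + e nu) μ = dQ L U₀ (shiftCfg aN F) (shiftCfg aN W) j z μ := by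
    rw [dQ_shiftCfg, ← haN, hUN]
  -- the restricted data
  set p : S → 𝔸 := restr S F with hp
  set V : S → 𝔸 := restr S (shiftCfg aL F) - restr S F with hV
  set W' : S → 𝔸 := restr S (shiftCfg aN F) - restr S F with hW'
  set Z : S → 𝔸 := restr S (dd2Cfg aL aN F) with hZ
  set u : S → 𝔸 := restr S W with hu
  set dL : S → 𝔸 := restr S (shiftCfg aL W) - restr S W with hdL
  set dN : S → 𝔸 := restr S (shiftCfg aN W) - restr S W with hdN
  set d2 : S → 𝔸 := restr S (dd2Cfg aL aN W) with hd2
  have hq10 : restr S (shiftCfg aL F) = p + V := by rw [hp, hV]; abel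
  have hq01 : restr S (shiftCfg aN F) = p + W' := by rw [hp, hW']; abel
  have hq11 : restr S (shiftCfg (aL + aN) F) = p + V + W' + Z := by rw [restr_shift2_eq, hp, hV, hW', hZ]
  have hu10 : restr S (shiftCfg aL W) = u + dL := by rw [hu, hdL]; abel
  have hu01 : restr S (shiftCfg aN W) = u + dN := by rw [hu, hdN]; abel
  have hu11 : restr S (shiftCfg (aL + aN) W) = u + dL + dN + d2 := by rw [restr_shift2_eq, hu, hdL, hdN, hd2]
  -- sizes
  have hpn : ‖p‖ ≤ b := norm_restr_le S F hb hF
  have hVn : ‖V‖ ≤ (L : ℝ) ^ j * gL := norm_restr_shift_sub_le S F L j lam hgL0 hgL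
  have hW'n : ‖W'‖ ≤ (L : ℝ) ^ j * gN := norm_restr_shift_sub_le S F L j nu hgN0 hgN
  have hZn : ‖Z‖ ≤ (L : ℝ) ^ j * g₂ := norm_restr_dd2Cfg_le S aL F L j nu hg₂0 hG
  have hun : ‖u‖ ≤ ω := norm_restr_le S W hω hW
  have hdLn : ‖dL‖ ≤ (L : ℝ) ^ j * gWL := norm_restr_shift_sub_le S W L j lam hgWL0 hgWL
  have hdNn : ‖dN‖ ≤ (L : ℝ) ^ j * gWN := norm_restr_shift_sub_le S W L j nu hgWN0 hgWN
  have hd2n : ‖d2‖ ≤ (L : ℝ) ^ j * g₂W := norm_restr_dd2Cfg_le S aL W L j nu hg₂W0 hGW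
  have hq10n : ‖p + V‖ ≤ b := by
    rw [← hq10]; exact norm_restr_le S _ hb fun x κ => by simpa [shiftCfg] using hF (x + aL) κ
  have hq01n : ‖p + W'‖ ≤ b := by
    rw [← hq01]; exact norm_restr_le S _ hb fun x κ => by simpa [shiftCfg] using hF (x + aN) κ
  have hq11n : ‖p + V + W' + Z‖ ≤ b := by
    rw [← hq11]; exact norm_restr_le S _ hb fun x κ => by simpa [shiftCfg] using hF (x + (aL + aN)) κ
  -- the increments of (II), (III): `q₁₁ − q₁₀ = (t_ν(t_λF) − t_λF)|_S`, `q₁₁ − q₀₁ = (t_λ(t_νF) − t_νF)|_S`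
  have hD10 : ‖(p + V + W' + Z) - (p + V)‖ ≤ (L : ℝ) ^ j * gN := by
    rw [← hq11, ← hq10, add_comm aL aN, ← shiftCfg_shiftCfg]
    exact norm_restr_shift_sub_le S (shiftCfg aL F) L j nu hgN0 fun x κ => by
      simpa [shiftCfg, add_right_comm x (e nu) aL] using hgN (x + aL) κ
  have hD01 : ‖(p + V + W' + Z) - (p + W')‖ ≤ (L : ℝ) ^ j * gL := by
    rw [← hq11, ← hq01, ← shiftCfg_shiftCfg]
    exact norm_restr_shift_sub_le S (shiftCfg aN F) L j lam hgL0 fun x κ => by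
      simpa [shiftCfg, add_right_comm x (e lam) aN] using hgL (x + aN) κ
  -- ball memberships (all four base points have sup norm ≤ b < b₁)
  have hb₁ : b < b₁ := by nlinarith
  have mem_p : p ∈ ball (0 : S → 𝔸) b₁ := by rw [mem_ball_zero_iff]; linarith
  have mem_10 : p + V ∈ ball (0 : S → 𝔸) b₁ := by rw [mem_ball_zero_iff]; linarith
  have mem_01 : p + W' ∈ ball (0 : S → 𝔸) b₁ := by rw [mem_ball_zero_iff]; linarith
  have mem_11 : p + V + W' + Z ∈ ball (0 : S → 𝔸) b₁ := by rw [mem_ball_zero_iff]; linarith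
  -- chart identifications
  have e11 : dQ L U₀ (shiftCfg (aL + aN) F) (shiftCfg (aL + aN) W) j z μ
      = fderiv ℂ φ (p + V + W' + Z) (u + dL + dN + d2) := by
    have hd : DifferentiableAt ℂ φ (restr S (shiftCfg (aL + aN) F)) := by rw [hq11]; exact (hφ _ mem_11).differentiableAt
    rw [dQ_eq_fderiv_of_chart L U₀ j z μ φ hchart _ _ hd, hq11, hu11]
  have e10 : dQ L U₀ (shiftCfg aL F) (shiftCfg aL W) j z μ = fderiv ℂ φ (p + V) (u + dL) := by
    have hd : DifferentiableAt ℂ φ (restr S (shiftCfg aL F)) := by rw [hq10]; exact (hφ _ mem_10).differentiableAt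
    rw [dQ_eq_fderiv_of_chart L U₀ j z μ φ hchart _ _ hd, hq10, hu10]
  have e01 : dQ L U₀ (shiftCfg aN F) (shiftCfg aN W) j z μ = fderiv ℂ φ (p + W') (u + dN) := by
    have hd : DifferentiableAt ℂ φ (restr S (shiftCfg aN F)) := by rw [hq01]; exact (hφ _ mem_01).differentiableAt
    rw [dQ_eq_fderiv_of_chart L U₀ j z μ φ hchart _ _ hd, hq01, hu01]
  have e00 : dQ L U₀ F W j z μ = fderiv ℂ φ p u :=
    dQ_eq_fderiv_of_chart L U₀ j z μ φ hchart _ _ (hφ _ mem_p).differentiableAt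
  -- the holomorphic maps `q ↦ Dφ(q)[v]` on the ball of radius `b₁ − ρ`, bounded by `M‖v‖/ρ`
  have hsub : ball (0 : S → 𝔸) (b₁ - ρ) ⊆ ball 0 b₁ := ball_subset_ball (by linarith)
  have hψ : ∀ v : S → 𝔸, DifferentiableOn ℂ (fun q => fderiv ℂ φ q v) (ball 0 (b₁ - ρ)) := fun v =>
    (differentiableOn_fderiv_apply hφ v).mono hsub
  have hψM : ∀ v : S → 𝔸, ∀ q ∈ ball (0 : S → 𝔸) (b₁ - ρ), ‖fderiv ℂ φ q v‖ ≤ M * ‖v‖ / ρ := fun v q hq =>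
    norm_fderiv_apply_le_of_chart hφ.differentiableOn hM hρ q v (by rw [mem_ball_zero_iff] at hq; linarith)
  -- (Ia) the Z-correction
  have hIa : ‖fderiv ℂ φ (p + V + W' + Z) u - fderiv ℂ φ (p + V + W') u‖ ≤ M * ω / ρ * ((L : ℝ) ^ j * g₂ / ρ) := by
    have hroomIa : ‖p + V + W'‖ + ‖Z‖ + ρ ≤ b₁ - ρ := by
      have : ‖p + V + W'‖ ≤ b + (L : ℝ) ^ j * gL + (L : ℝ) ^ j * gN :=
        le_trans (norm_add_le _ _) (add_le_add (le_trans (norm_add_le _ _) (add_le_add hpn hVn)) hW'n)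
      linarith
    calc ‖fderiv ℂ φ (p + V + W' + Z) u - fderiv ℂ φ (p + V + W') u‖ ≤ M * ‖u‖ / ρ * ‖Z‖ / ρ :=
          norm_sub_le_of_chart (hψ u) (hψM u) hρ (p + V + W') Z hroomIa
      _ ≤ M * ω / ρ * ((L : ℝ) ^ j * g₂) / ρ := by
          refine div_le_div_of_nonneg_right ?_ hρ.le
          exact mul_le_mul (div_le_div_of_nonneg_right (mul_le_mul_of_nonneg_left hun hM0) hρ.le) hZn (norm_nonneg _)
            (by positivity)
      _ = M * ω / ρ * ((L : ℝ) ^ j * g₂ / ρ) := by ring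
  -- (Ib) the pure mixed second difference
  have hIb : ‖fderiv ℂ φ (p + V + W') u - fderiv ℂ φ (p + V) u - fderiv ℂ φ (p + W') u + fderiv ℂ φ p u‖
      ≤ M * ω / ρ * (((L : ℝ) ^ j * gL) * ((L : ℝ) ^ j * gN) / ρ ^ 2) := by
    have hmem : ∀ s t : ℂ, ‖s‖ * ‖V‖ < ‖V‖ + ρ → ‖t‖ * ‖W'‖ < ‖W'‖ + ρ → p + s • V + t • W' ∈ ball (0 : S → 𝔸) (b₁ - ρ) := by
      intro s t hs ht
      rw [mem_ball_zero_iff]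
      calc ‖p + s • V + t • W'‖ ≤ ‖p‖ + ‖s • V‖ + ‖t • W'‖ := norm_add₃_le
        _ = ‖p‖ + ‖s‖ * ‖V‖ + ‖t‖ * ‖W'‖ := by rw [norm_smul, norm_smul]
        _ < b + ((L : ℝ) ^ j * gL + ρ) + ((L : ℝ) ^ j * gN + ρ) := by linarith
        _ ≤ b₁ - ρ := by linarith
    have hMψ : ∀ q ∈ ball (0 : S → 𝔸) (b₁ - ρ), ‖fderiv ℂ φ q u‖ ≤ M * ω / ρ := fun q hq =>
      le_trans (hψM u q hq) (div_le_div_of_nonneg_right (mul_le_mul_of_nonneg_left hun hM0) hρ.le)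
    calc ‖fderiv ℂ φ (p + V + W') u - fderiv ℂ φ (p + V) u - fderiv ℂ φ (p + W') u + fderiv ℂ φ p u‖
        ≤ M * ω / ρ * ‖V‖ * ‖W'‖ / ρ ^ 2 :=
          norm_secondDiff_le isOpen_ball (hψ u) (by positivity) hρ p V W' hmem hMψ
      _ ≤ M * ω / ρ * ((L : ℝ) ^ j * gL) * ((L : ℝ) ^ j * gN) / ρ ^ 2 := by
          refine div_le_div_of_nonneg_right ?_ (by positivity)
          exact mul_le_mul (mul_le_mul_of_nonneg_left hVn (by positivity)) hW'n (norm_nonneg _) (by positivity)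
      _ = M * ω / ρ * (((L : ℝ) ^ j * gL) * ((L : ℝ) ^ j * gN) / ρ ^ 2) := by ring
  -- (II) and (III) the cross terms
  have hII : ‖fderiv ℂ φ (p + V + W' + Z) dL - fderiv ℂ φ (p + V) dL‖ ≤ M * (((L : ℝ) ^ j * gWL) * ((L : ℝ) ^ j * gN)) / ρ ^ 2 := by
    have hroomII : ‖p + V‖ + ‖(p + V + W' + Z) - (p + V)‖ + ρ ≤ b₁ - ρ := by linarith
    have h := norm_sub_le_of_chart (hψ dL) (hψM dL) hρ (p + V) ((p + V + W' + Z) - (p + V)) hroomII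
    rw [add_sub_cancel] at h
    calc ‖fderiv ℂ φ (p + V + W' + Z) dL - fderiv ℂ φ (p + V) dL‖ ≤ M * ‖dL‖ / ρ * ‖(p + V + W' + Z) - (p + V)‖ / ρ := h
      _ ≤ M * ((L : ℝ) ^ j * gWL) / ρ * ((L : ℝ) ^ j * gN) / ρ := by
          refine div_le_div_of_nonneg_right ?_ hρ.le
          exact mul_le_mul (div_le_div_of_nonneg_right (mul_le_mul_of_nonneg_left hdLn hM0) hρ.le) hD10 (norm_nonneg _)
            (by positivity)
      _ = M * (((L : ℝ) ^ j * gWL) * ((L : ℝ) ^ j * gN)) / ρ ^ 2 := by ring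
  have hIII : ‖fderiv ℂ φ (p + V + W' + Z) dN - fderiv ℂ φ (p + W') dN‖ ≤ M * (((L : ℝ) ^ j * gWN) * ((L : ℝ) ^ j * gL)) / ρ ^ 2 := by
    have hroomIII : ‖p + W'‖ + ‖(p + V + W' + Z) - (p + W')‖ + ρ ≤ b₁ - ρ := by linarith
    have h := norm_sub_le_of_chart (hψ dN) (hψM dN) hρ (p + W') ((p + V + W' + Z) - (p + W')) hroomIII
    rw [add_sub_cancel] at h
    calc ‖fderiv ℂ φ (p + V + W' + Z) dN - fderiv ℂ φ (p + W') dN‖ ≤ M * ‖dN‖ / ρ * ‖(p + V + W' + Z) - (p + W')‖ / ρ := h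
      _ ≤ M * ((L : ℝ) ^ j * gWN) / ρ * ((L : ℝ) ^ j * gL) / ρ := by
          refine div_le_div_of_nonneg_right ?_ hρ.le
          exact mul_le_mul (div_le_div_of_nonneg_right (mul_le_mul_of_nonneg_left hdNn hM0) hρ.le) hD01 (norm_nonneg _)
            (by positivity)
      _ = M * (((L : ℝ) ^ j * gWN) * ((L : ℝ) ^ j * gL)) / ρ ^ 2 := by ring
  -- (IV) the double difference of the direction
  have hIV : ‖fderiv ℂ φ (p + V + W' + Z) d2‖ ≤ M * ((L : ℝ) ^ j * g₂W) / ρ := by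
    calc ‖fderiv ℂ φ (p + V + W' + Z) d2‖ ≤ M * ‖d2‖ / ρ :=
          norm_fderiv_apply_le_of_chart hφ.differentiableOn hM hρ _ d2 (by linarith)
      _ ≤ M * ((L : ℝ) ^ j * g₂W) / ρ := div_le_div_of_nonneg_right (mul_le_mul_of_nonneg_left hd2n hM0) hρ.le
  -- assemble
  rw [c11, c10, c01, e11, e10, e01, e00]
  have hsplit := secondDiff_split (fderiv ℂ φ) (p + V + W' + Z) (p + V) (p + W') p (p + V + W') u dL dN d2
  rw [hsplit]
  refine le_trans (norm_add₅_le _ _ _ _ _) ?_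
  have hsum := add_le_add (add_le_add (add_le_add (add_le_add hIa hIb) hII) hIII) hIV
  refine le_trans hsum (le_of_eq ?_)
  ring

end Invariant

/-! ## §3 The inputs discharged at the flat background -/

section Flat

variable {𝔸 : Type*} [NormedRing 𝔸] [NormedAlgebra ℂ 𝔸] [CompleteSpace 𝔸]

/-- **(4.18) FOR `δB` AT `U₀ = 1`** (the print's `U_j(□₀, 1)`): for `L ≥ 2`, `C₃(d, L)·L^j·b₁ ≤ 1` and the data/margin hypotheses of
`ineq418_deltaB_invariant`, `‖Δ_λΔ_ν δB_μ(z)‖ ≤ (2L^jb₁·ω/ρ)(L^jg₂/ρ + L^jg_λ·L^jg_ν/ρ²) + 2L^jb₁(L^jg^W_λ·L^jg_ν + L^jg^W_ν·L^jg_λ)/ρ²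
+ 2L^jb₁·L^jg₂^W/ρ` — chart `B12Ineq417Flat.logIter_eq_avgMap_restr`, analyticity `B7Prop5FlatOperator.analyticAt_avgMap_apply`, size (131)
`B12Ineq417Flat.norm_logIter_le`.  With the DICTIONARY of the header every term is `O(1)(L^jη)^{2+β}`: «The inequalities (4.17), (4.18) hold for the
field δB also» ((4.18) half). [cite: Balaban1987RG1, (4.18) p.285, (4.6) p.282; Balaban1985Averaging, Prop. 4 p.38, (131) p.38] -/
theorem ineq418_deltaB_flat (L : ℕ) (hL : 2 ≤ L) (F W : B7Prop1Explicit.Site d → Fin d → 𝔸) (j : ℕ) (lam nu : Fin d)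
    (z : B7Prop1Explicit.Site d) (μ : Fin d) {b b₁ ω gL gN g₂ gWL gWN g₂W ρ : ℝ} (hb : 0 ≤ b)
    (hk : C3 d L * ((L : ℝ) ^ j * b₁) ≤ 1) (hF : ∀ x κ, ‖F x κ‖ ≤ b)
    (hgL0 : 0 ≤ gL) (hgL : ∀ x κ, ‖F (x + e lam) κ - F x κ‖ ≤ gL)
    (hgN0 : 0 ≤ gN) (hgN : ∀ x κ, ‖F (x + e nu) κ - F x κ‖ ≤ gN)
    (hg₂0 : 0 ≤ g₂) (hG : ∀ y κ, ‖(F (y + ((L : ℤ) ^ j) • e lam + e nu) κ - F (y + ((L : ℤ) ^ j) • e lam) κ)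
      - (F (y + e nu) κ - F y κ)‖ ≤ g₂)
    (hω : 0 ≤ ω) (hW : ∀ x κ, ‖W x κ‖ ≤ ω)
    (hgWL0 : 0 ≤ gWL) (hgWL : ∀ x κ, ‖W (x + e lam) κ - W x κ‖ ≤ gWL)
    (hgWN0 : 0 ≤ gWN) (hgWN : ∀ x κ, ‖W (x + e nu) κ - W x κ‖ ≤ gWN)
    (hg₂W0 : 0 ≤ g₂W) (hGW : ∀ y κ, ‖(W (y + ((L : ℤ) ^ j) • e lam + e nu) κ - W (y + ((L : ℤ) ^ j) • e lam) κ)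
      - (W (y + e nu) κ - W y κ)‖ ≤ g₂W)
    (hρ : 0 < ρ) (hroom : b + (L : ℝ) ^ j * gL + (L : ℝ) ^ j * gN + (L : ℝ) ^ j * g₂ + 3 * ρ ≤ b₁) :
    ‖dQ L (1 : B7Prop1Explicit.Site d → Fin d → 𝔸ˣ) F W j (z + e lam + e nu) μ
        - dQ L (1 : B7Prop1Explicit.Site d → Fin d → 𝔸ˣ) F W j (z + e lam) μ
        - dQ L (1 : B7Prop1Explicit.Site d → Fin d → 𝔸ˣ) F W j (z + e nu) μ
        + dQ L (1 : B7Prop1Explicit.Site d → Fin d → 𝔸ˣ) F W j z μ‖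
      ≤ 2 * ((L : ℝ) ^ j * b₁) * ω / ρ * ((L : ℝ) ^ j * g₂ / ρ + ((L : ℝ) ^ j * gL) * ((L : ℝ) ^ j * gN) / ρ ^ 2)
        + 2 * ((L : ℝ) ^ j * b₁) * (((L : ℝ) ^ j * gWL) * ((L : ℝ) ^ j * gN) + ((L : ℝ) ^ j * gWN) * ((L : ℝ) ^ j * gL)) / ρ ^ 2
        + 2 * ((L : ℝ) ^ j * b₁) * ((L : ℝ) ^ j * g₂W) / ρ := by
  have hL1 : 1 ≤ L := le_trans (by norm_num) hL
  have hb₁0 : 0 ≤ b₁ := by nlinarith [pow_nonneg (Nat.cast_nonneg L : (0 : ℝ) ≤ L) j]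
  set S := boxBonds L j z μ with hS
  set T := oneBond (d := d) z μ with hT
  have hchart : ∀ G : B7Prop1Explicit.Site d → Fin d → 𝔸,
      logCovIter L (1 : B7Prop1Explicit.Site d → Fin d → 𝔸ˣ) G j z μ = (fun q : S → 𝔸 => avgMap L S T j q (theBond z μ)) (restr S G) := by
    intro G
    rw [logCovIter_one_left]
    exact logIter_eq_avgMap_restr L hL1 G j z μ
  have hφ : AnalyticOnNhd ℂ (fun q : S → 𝔸 => avgMap L S T j q (theBond z μ)) (ball 0 b₁) := by
    intro q hq
    have hq' : ∀ s, ‖q s‖ ≤ b₁ := fun s => le_trans (norm_le_pi_norm q s) (mem_ball_zero_iff.1 hq).le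
    exact analyticAt_avgMap_apply L hL S T j hb₁0 hk hq' (theBond z μ)
  have hM : ∀ q ∈ ball (0 : S → 𝔸) b₁, ‖(fun q : S → 𝔸 => avgMap L S T j q (theBond z μ)) q‖ ≤ 2 * ((L : ℝ) ^ j * b₁) := by
    intro q hq
    have hq' : ∀ s, ‖q s‖ ≤ b₁ := fun s => le_trans (norm_le_pi_norm q s) (mem_ball_zero_iff.1 hq).le
    simp only [avgMap_apply]
    exact norm_logIter_le L hL (insCfg S q) j hb₁0 hk (norm_insCfg_le_of_le hb₁0 hq') _ _
  exact ineq418_deltaB_invariant L (1 : B7Prop1Explicit.Site d → Fin d → 𝔸ˣ) F W j lam nu z μ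
    (fun q : S → 𝔸 => avgMap L S T j q (theBond z μ)) hchart (shiftCfg_one _) (shiftCfg_one _) hφ (by positivity) hM hb hF
    hgL0 hgL hgN0 hgN hg₂0 hG hω hW hgWL0 hgWL hgWN0 hgWN hg₂W0 hGW hρ hroom

end Flat

end Literature.MathematicalPhysics.QuantumFieldTheory.Balaban1983to89.B12Ineq418DeltaB

end
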